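import Mathlib

/-!
# The transportation problem: feasibility, redundancy, existence of an optimum, and the simplex-multiplier optimality test (Luenberger–Ye §5.1, §5.4)

Source: D. G. Luenberger, Y. Ye, *Linear and Nonlinear Programming*, 3rd ed., Springer (2008)
[`LuenbergerYe2008`], Chapter 5 *Transportation and Network Flow Problems* (held-copy numbering;
Chapter 6 of the Springer printing), §5.1 *The Transportation Problem* ((1)–(6) and the Theorem on
feasibility and redundancy) and §5.4 *Simplex Method for Transportation Problems* (simplex
multipliers `u, v`, (9)–(10), optimality when all relative costs are nonnegative).

The problem ((2)): given supplies `a : ι → ℝ`, demands `b : κ → ℝ` (nonnegative, *balanced*: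
`Σ aᵢ = Σ bⱼ`, (1)) and unit costs `c`, minimise `Σᵢⱼ cᵢⱼ xᵢⱼ` over `x ≥ 0` with row sums `a` and
column sums `b`.

## Contents

* `IsFeasible a b x`, `cost c x`, `proportionalPlan a b` (`xᵢⱼ = aᵢ bⱼ / S`, `S = Σ aᵢ`).
* §5.1, feasibility: `proportionalPlan_isFeasible` — the proportional plan is feasible for every
  balanced problem with nonnegative data; `le_supply`, `le_demand` — every feasible `xᵢⱼ` is bounded
  by `aᵢ` and by `bⱼ`.
* §5.1, redundancy ((5) = (6)): `sum_rows_eq_sum_cols`; `colSum_of_others` — a dropped demand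
  equation is reconstructed from the remaining ones and the balance condition (likewise
  `rowSum_of_others`); `combination_eq_zero` — after dropping one equation the remaining
  `m + n − 1` are linearly independent (the book's proof: each `x_{i n}` occurs in one remaining
  equation only).
* §5.1, "a transportation problem always has an optimal solution": `isCompact_feasibleSet`,
  `exists_optimal`.
* §5.4: `relCost c u v i j = cᵢⱼ − uᵢ − vⱼ` ((10)); `dual_objective_eq` — for feasible `x`,
  `Σᵢⱼ (uᵢ + vⱼ) xᵢⱼ = Σ uᵢ aᵢ + Σ vⱼ bⱼ`; `cost_eq_dual_add_relCost`;
  `optimal_of_relCost_nonneg` — if all relative costs are `≥ 0` and vanish on the cells used by a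
  feasible `x` ((9) on the basic cells), then `x` is optimal; `cost_lower_bound` (weak duality:
  `uᵢ + vⱼ ≤ cᵢⱼ` everywhere gives `Σ uᵢaᵢ + Σ vⱼbⱼ ≤ cost`).

Not formalised: the Basis Triangularity Theorem of §5.3 and its integrality corollaries, the
northwest-corner rule (§5.2), the cycle-of-change pivot (§5.4).
-/

namespace Literature.Analysis.Convex.TransportationProblem

open Finset BigOperators

variable {ι κ : Type*} [Fintype ι] [Fintype κ]

/-! ### The problem ((1)–(2)) -/

/-- Feasibility for the transportation problem (2): row sums `a`, column sums `b`, `x ≥ 0`.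
[cite: LuenbergerYe2008, §5.1 (2)–(3)] -/
structure IsFeasible (a : ι → ℝ) (b : κ → ℝ) (x : ι → κ → ℝ) : Prop where
  rowSum : ∀ i, ∑ j, x i j = a i
  colSum : ∀ j, ∑ i, x i j = b j
  nonneg : ∀ i j, 0 ≤ x i j

/-- The total shipping cost `Σᵢ Σⱼ cᵢⱼ xᵢⱼ` ((2)). [cite: LuenbergerYe2008, §5.1 (2)] -/
def cost (c x : ι → κ → ℝ) : ℝ := ∑ i, ∑ j, c i j * x i j

/-- The proportional plan `xᵢⱼ = aᵢ bⱼ / S`, `S = Σ aᵢ` the total supply.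
[cite: LuenbergerYe2008, §5.1 Feasibility and Redundancy] -/
noncomputable def proportionalPlan (a : ι → ℝ) (b : κ → ℝ) : ι → κ → ℝ :=
  fun i j => a i * b j / ∑ k, a k

/-! ### §5.1 Feasibility -/

/-- **Feasibility (§5.1 Theorem, first part).** For nonnegative balanced data the proportional plan
`xᵢⱼ = aᵢ bⱼ / S` is feasible; in particular every transportation problem has a feasible solution.
(If `S = 0` all data vanish and the plan is `0`.) [cite: LuenbergerYe2008, §5.1 Theorem] -/
theorem proportionalPlan_isFeasible {a : ι → ℝ} {b : κ → ℝ} (ha : ∀ i, 0 ≤ a i) (hb : ∀ j, 0 ≤ b j)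
    (hbal : ∑ i, a i = ∑ j, b j) : IsFeasible a b (proportionalPlan a b) := by
  classical
  by_cases hS : ∑ k, a k = 0
  · -- degenerate data: everything is zero
    have ha0 : ∀ i, a i = 0 := fun i =>
      (Finset.sum_eq_zero_iff_of_nonneg (fun k _ => ha k)).1 hS i (mem_univ i)
    have hb0 : ∀ j, b j = 0 := fun j =>
      (Finset.sum_eq_zero_iff_of_nonneg (fun k _ => hb k)).1 (hbal ▸ hS) j (mem_univ j)
    refine ⟨fun i => ?_, fun j => ?_, fun i j => ?_⟩
    · simp [proportionalPlan, ha0]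
    · simp [proportionalPlan, hb0, ha0]
    · simp [proportionalPlan, ha0]
  refine ⟨fun i => ?_, fun j => ?_, fun i j => ?_⟩
  · simp only [proportionalPlan]
    rw [← Finset.sum_div, ← Finset.mul_sum, ← hbal, mul_div_assoc, div_self hS, mul_one]
  · simp only [proportionalPlan]
    rw [← Finset.sum_div, ← Finset.sum_mul, mul_comm, mul_div_assoc, div_self hS, mul_one]
  · exact div_nonneg (mul_nonneg (ha i) (hb j)) (Finset.sum_nonneg fun k _ => ha k)

/-- There is always a feasible solution. [cite: LuenbergerYe2008, §5.1 Theorem] -/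
theorem exists_isFeasible {a : ι → ℝ} {b : κ → ℝ} (ha : ∀ i, 0 ≤ a i) (hb : ∀ j, 0 ≤ b j)
    (hbal : ∑ i, a i = ∑ j, b j) : ∃ x, IsFeasible a b x :=
  ⟨_, proportionalPlan_isFeasible ha hb hbal⟩

/-- Each feasible `xᵢⱼ` is bounded by the supply `aᵢ` ("the solutions are bounded").
[cite: LuenbergerYe2008, §5.1 Feasibility and Redundancy] -/
theorem le_supply {a : ι → ℝ} {b : κ → ℝ} {x : ι → κ → ℝ} (hx : IsFeasible a b x) (i : ι) (j : κ) :
    x i j ≤ a i := by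
  rw [← hx.rowSum i]
  exact Finset.single_le_sum (fun k _ => hx.nonneg i k) (mem_univ j)

/-- Each feasible `xᵢⱼ` is bounded by the demand `bⱼ`. [cite: LuenbergerYe2008, §5.1 Feasibility and Redundancy] -/
theorem le_demand {a : ι → ℝ} {b : κ → ℝ} {x : ι → κ → ℝ} (hx : IsFeasible a b x) (i : ι) (j : κ) :
    x i j ≤ b j := by
  rw [← hx.colSum j]
  exact Finset.single_le_sum (f := fun k => x k j) (fun k _ => hx.nonneg k j) (mem_univ i)

/-- A feasible problem is balanced: (5) and (6) have equal left-hand sides.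
[cite: LuenbergerYe2008, §5.1 (5)–(6)] -/
theorem balanced_of_isFeasible {a : ι → ℝ} {b : κ → ℝ} {x : ι → κ → ℝ} (hx : IsFeasible a b x) :
    ∑ i, a i = ∑ j, b j := by
  simp_rw [← hx.rowSum, ← hx.colSum]
  exact Finset.sum_comm

/-! ### §5.1 Redundancy: exactly one redundant equation -/

/-- (5) = (6): the sum of the origin equations and the sum of the destination equations have the
same left-hand side. [cite: LuenbergerYe2008, §5.1 (5)–(6)] -/
theorem sum_rows_eq_sum_cols (x : ι → κ → ℝ) : ∑ i, ∑ j, x i j = ∑ j, ∑ i, x i j :=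
  Finset.sum_comm

/-- **Any one demand equation can be dropped**: if `x` satisfies all origin equations and all
destination equations except the one for `j₀`, and the data are balanced, then the `j₀` equation
holds as well. [cite: LuenbergerYe2008, §5.1 Theorem] -/
theorem colSum_of_others [DecidableEq κ] {a : ι → ℝ} {b : κ → ℝ} {x : ι → κ → ℝ}
    (hbal : ∑ i, a i = ∑ j, b j) (hrow : ∀ i, ∑ j, x i j = a i) (j₀ : κ)
    (hcol : ∀ j, j ≠ j₀ → ∑ i, x i j = b j) : ∑ i, x i j₀ = b j₀ := by
  have h1 : ∑ j, ∑ i, x i j = ∑ j, b j := by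
    rw [← sum_rows_eq_sum_cols, ← hbal]; exact Finset.sum_congr rfl fun i _ => hrow i
  rw [← Finset.add_sum_erase _ _ (mem_univ j₀), ← Finset.add_sum_erase _ b (mem_univ j₀)] at h1
  have h2 : ∑ j ∈ univ.erase j₀, ∑ i, x i j = ∑ j ∈ univ.erase j₀, b j :=
    Finset.sum_congr rfl fun j hj => hcol j (ne_of_mem_erase hj)
  linarith

/-- Symmetrically, any one origin equation can be dropped. [cite: LuenbergerYe2008, §5.1 Theorem] -/
theorem rowSum_of_others [DecidableEq ι] {a : ι → ℝ} {b : κ → ℝ} {x : ι → κ → ℝ}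
    (hbal : ∑ i, a i = ∑ j, b j) (hcol : ∀ j, ∑ i, x i j = b j) (i₀ : ι)
    (hrow : ∀ i, i ≠ i₀ → ∑ j, x i j = a i) : ∑ j, x i₀ j = a i₀ := by
  have h1 : ∑ i, ∑ j, x i j = ∑ i, a i := by
    rw [sum_rows_eq_sum_cols, hbal]; exact Finset.sum_congr rfl fun j _ => hcol j
  rw [← Finset.add_sum_erase _ _ (mem_univ i₀), ← Finset.add_sum_erase _ a (mem_univ i₀)] at h1
  have h2 : ∑ i ∈ univ.erase i₀, ∑ j, x i j = ∑ i ∈ univ.erase i₀, a i :=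
    Finset.sum_congr rfl fun i hi => hrow i (ne_of_mem_erase hi)
  linarith

omit [Fintype ι] [Fintype κ] in
/-- **Linear independence of the remaining `m + n − 1` equations (§5.1 Theorem, second part).**
A linear combination of the constraint rows with coefficients `αᵢ` (origins) and `βⱼ` (destinations)
is the functional `x ↦ Σᵢⱼ (αᵢ + βⱼ) xᵢⱼ`; if it vanishes identically (`αᵢ + βⱼ = 0` for all
`i, j`) and the dropped destination equation `j₀` is not used (`β j₀ = 0`), then all coefficients
vanish (there is at least one origin, `m ≥ 1`). [cite: LuenbergerYe2008, §5.1 Theorem (proof)] -/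
theorem combination_eq_zero [Nonempty ι] {α : ι → ℝ} {β : κ → ℝ} (j₀ : κ) (hβ₀ : β j₀ = 0)
    (h : ∀ i j, α i + β j = 0) : (∀ i, α i = 0) ∧ ∀ j, β j = 0 := by
  have hα : ∀ i, α i = 0 := fun i => by simpa [hβ₀] using h i j₀
  obtain ⟨i⟩ := ‹Nonempty ι›
  exact ⟨hα, fun j => by simpa [hα i] using h i j⟩

/-- The combination functional: `Σᵢ αᵢ (Σⱼ xᵢⱼ) + Σⱼ βⱼ (Σᵢ xᵢⱼ) = Σᵢⱼ (αᵢ + βⱼ) xᵢⱼ` — the rows of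
the constraint matrix (4) combine cellwise. [cite: LuenbergerYe2008, §5.1 (3)–(4)] -/
theorem combination_apply (α : ι → ℝ) (β : κ → ℝ) (x : ι → κ → ℝ) :
    ∑ i, α i * ∑ j, x i j + ∑ j, β j * ∑ i, x i j = ∑ i, ∑ j, (α i + β j) * x i j := by
  simp_rw [Finset.mul_sum, add_mul, Finset.sum_add_distrib]
  rw [Finset.sum_comm (f := fun j i => β j * x i j)]

/-! ### §5.1 Existence of an optimal solution -/

/-- The feasible set. [cite: LuenbergerYe2008, §5.1 (2)] -/
def feasibleSet (a : ι → ℝ) (b : κ → ℝ) : Set (ι → κ → ℝ) := {x | IsFeasible a b x}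

omit [Fintype ι] in
/-- Row sums are continuous in the plan. [folklore] -/
private theorem continuous_rowSum (i : ι) : Continuous fun x : ι → κ → ℝ => ∑ j, x i j :=
  continuous_finsetSum _ fun j _ => (continuous_apply j).comp (continuous_apply i)

omit [Fintype κ] in
/-- Column sums are continuous in the plan. [folklore] -/
private theorem continuous_colSum (j : κ) : Continuous fun x : ι → κ → ℝ => ∑ i, x i j :=
  continuous_finsetSum _ fun i _ => (continuous_apply j).comp (continuous_apply i)

/-- The cost is continuous in the plan. [folklore] -/
private theorem continuous_cost (c : ι → κ → ℝ) : Continuous fun x : ι → κ → ℝ => cost c x :=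
  continuous_finsetSum _ fun i _ => continuous_finsetSum _ fun j _ =>
    continuous_const.mul ((continuous_apply j).comp (continuous_apply i))

/-- **The feasible region is compact** ("the solutions are bounded" and the constraints are closed).
[cite: LuenbergerYe2008, §5.1 Feasibility and Redundancy] -/
theorem isCompact_feasibleSet (a : ι → ℝ) (b : κ → ℝ) : IsCompact (feasibleSet a b) := by
  -- the box `0 ≤ x i j ≤ a i`
  have hbox : IsCompact (Set.Icc (0 : ι → κ → ℝ) (fun i _ => a i)) := isCompact_Icc
  refine hbox.of_isClosed_subset ?_ ?_
  · have h1 : IsClosed {x : ι → κ → ℝ | ∀ i, ∑ j, x i j = a i} := by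
      rw [Set.setOf_forall]
      exact isClosed_iInter fun i => isClosed_eq (continuous_rowSum i) continuous_const
    have h2 : IsClosed {x : ι → κ → ℝ | ∀ j, ∑ i, x i j = b j} := by
      rw [Set.setOf_forall]
      exact isClosed_iInter fun j => isClosed_eq (continuous_colSum j) continuous_const
    have h3 : IsClosed {x : ι → κ → ℝ | ∀ i j, 0 ≤ x i j} := by
      have : {x : ι → κ → ℝ | ∀ i j, 0 ≤ x i j} = ⋂ i, ⋂ j, {x | 0 ≤ x i j} := by
        ext x; simp
      rw [this]
      exact isClosed_iInter fun i => isClosed_iInter fun j =>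
        isClosed_le continuous_const ((continuous_apply j).comp (continuous_apply i))
    have heq : feasibleSet a b = {x | ∀ i, ∑ j, x i j = a i} ∩ {x | ∀ j, ∑ i, x i j = b j} ∩
        {x | ∀ i j, 0 ≤ x i j} := by
      ext x
      simp only [feasibleSet, Set.mem_setOf_eq, Set.mem_inter_iff]
      exact ⟨fun h => ⟨⟨h.rowSum, h.colSum⟩, h.nonneg⟩, fun h => ⟨h.1.1, h.1.2, h.2⟩⟩
    rw [heq]
    exact (h1.inter h2).inter h3
  · intro x hx
    exact ⟨fun i j => hx.nonneg i j, fun i j => le_supply hx i j⟩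

/-- **A transportation problem always has an optimal solution** (§5.1: "a bounded program with a
feasible solution has an optimal solution"). [cite: LuenbergerYe2008, §5.1 Feasibility and Redundancy] -/
theorem exists_optimal {a : ι → ℝ} {b : κ → ℝ} (c : ι → κ → ℝ) (ha : ∀ i, 0 ≤ a i)
    (hb : ∀ j, 0 ≤ b j) (hbal : ∑ i, a i = ∑ j, b j) :
    ∃ x, IsFeasible a b x ∧ ∀ y, IsFeasible a b y → cost c x ≤ cost c y := by
  obtain ⟨x, hx, hmin⟩ := (isCompact_feasibleSet a b).exists_isMinOn
    ⟨_, proportionalPlan_isFeasible ha hb hbal⟩ (continuous_cost c).continuousOn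
  exact ⟨x, hx, fun y hy => hmin hy⟩

/-! ### §5.4 Simplex multipliers and the optimality test -/

/-- The relative cost coefficients `rᵢⱼ = cᵢⱼ − uᵢ − vⱼ` ((10)) of the multipliers `λ = (u, v)`.
[cite: LuenbergerYe2008, §5.4 (10)] -/
def relCost (c : ι → κ → ℝ) (u : ι → ℝ) (v : κ → ℝ) (i : ι) (j : κ) : ℝ := c i j - u i - v j

/-- **The dual objective**: for a feasible plan, `Σᵢⱼ (uᵢ + vⱼ) xᵢⱼ = Σ uᵢ aᵢ + Σ vⱼ bⱼ` (`λᵀA x = λᵀ b`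
with the constraint matrix (4)). [cite: LuenbergerYe2008, §5.4 Simplex Multipliers] -/
theorem dual_objective_eq {a : ι → ℝ} {b : κ → ℝ} {x : ι → κ → ℝ} (hx : IsFeasible a b x)
    (u : ι → ℝ) (v : κ → ℝ) : ∑ i, ∑ j, (u i + v j) * x i j = ∑ i, u i * a i + ∑ j, v j * b j := by
  rw [← combination_apply]
  simp_rw [hx.rowSum, hx.colSum]

/-- `cost = dual objective + Σᵢⱼ rᵢⱼ xᵢⱼ` for feasible `x`. [cite: LuenbergerYe2008, §5.4 (9)–(10)] -/
theorem cost_eq_dual_add_relCost {a : ι → ℝ} {b : κ → ℝ} {x : ι → κ → ℝ} (hx : IsFeasible a b x)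
    (c : ι → κ → ℝ) (u : ι → ℝ) (v : κ → ℝ) :
    cost c x = (∑ i, u i * a i + ∑ j, v j * b j) + ∑ i, ∑ j, relCost c u v i j * x i j := by
  rw [← dual_objective_eq hx, cost, ← Finset.sum_add_distrib]
  refine Finset.sum_congr rfl fun i _ => ?_
  rw [← Finset.sum_add_distrib]
  refine Finset.sum_congr rfl fun j _ => ?_
  simp only [relCost]; ring

/-- **Weak duality for the transportation problem**: if `uᵢ + vⱼ ≤ cᵢⱼ` for all cells (all relative
costs nonnegative), then `Σ uᵢ aᵢ + Σ vⱼ bⱼ ≤ cost c x` for every feasible `x`.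
[cite: LuenbergerYe2008, §5.4 Simplex Multipliers] -/
theorem cost_lower_bound {a : ι → ℝ} {b : κ → ℝ} {x : ι → κ → ℝ} (hx : IsFeasible a b x)
    {c : ι → κ → ℝ} {u : ι → ℝ} {v : κ → ℝ} (hr : ∀ i j, 0 ≤ relCost c u v i j) :
    ∑ i, u i * a i + ∑ j, v j * b j ≤ cost c x := by
  rw [cost_eq_dual_add_relCost hx c u v]
  have : 0 ≤ ∑ i, ∑ j, relCost c u v i j * x i j :=
    Finset.sum_nonneg fun i _ => Finset.sum_nonneg fun j _ => mul_nonneg (hr i j) (hx.nonneg i j)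
  linarith

/-- **Optimality test of the transportation simplex method (§5.4).** Let `x` be feasible and let
multipliers `u, v` satisfy `uᵢ + vⱼ = cᵢⱼ` on every cell that `x` uses ((9) on the basic cells) and
`rᵢⱼ = cᵢⱼ − uᵢ − vⱼ ≥ 0` on all cells. Then `x` is optimal. [cite: LuenbergerYe2008, §5.4 Simplex Multipliers, (9)–(10)] -/
theorem optimal_of_relCost_nonneg {a : ι → ℝ} {b : κ → ℝ} {x : ι → κ → ℝ} (hx : IsFeasible a b x)
    {c : ι → κ → ℝ} {u : ι → ℝ} {v : κ → ℝ} (hr : ∀ i j, 0 ≤ relCost c u v i j)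
    (hcs : ∀ i j, 0 < x i j → relCost c u v i j = 0) :
    ∀ y, IsFeasible a b y → cost c x ≤ cost c y := by
  intro y hy
  have hx0 : ∑ i, ∑ j, relCost c u v i j * x i j = 0 := by
    refine Finset.sum_eq_zero fun i _ => Finset.sum_eq_zero fun j _ => ?_
    rcases (hx.nonneg i j).eq_or_lt with h | h
    · rw [← h, mul_zero]
    · rw [hcs i j h, zero_mul]
  have h1 := cost_eq_dual_add_relCost hx c u v
  rw [hx0, add_zero] at h1
  rw [h1]
  exact cost_lower_bound hy hr

/-- The optimal value then equals the dual objective `Σ uᵢ aᵢ + Σ vⱼ bⱼ`.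
[cite: LuenbergerYe2008, §5.4 Simplex Multipliers] -/
theorem cost_eq_dual_of_relCost {a : ι → ℝ} {b : κ → ℝ} {x : ι → κ → ℝ} (hx : IsFeasible a b x)
    {c : ι → κ → ℝ} {u : ι → ℝ} {v : κ → ℝ}
    (hcs : ∀ i j, 0 < x i j → relCost c u v i j = 0) :
    cost c x = ∑ i, u i * a i + ∑ j, v j * b j := by
  have hx0 : ∑ i, ∑ j, relCost c u v i j * x i j = 0 := by
    refine Finset.sum_eq_zero fun i _ => Finset.sum_eq_zero fun j _ => ?_
    rcases (hx.nonneg i j).eq_or_lt with h | h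
    · rw [← h, mul_zero]
    · rw [hcs i j h, zero_mul]
  rw [cost_eq_dual_add_relCost hx c u v, hx0, add_zero]

omit [Fintype ι] [Fintype κ] in
/-- One multiplier may be fixed arbitrarily (§5.4: "an arbitrary value may be assigned to any one of
the multipliers", e.g. `vₙ = 0`): shifting `u ↦ u + t`, `v ↦ v − t` changes no relative cost.
[cite: LuenbergerYe2008, §5.4 Simplex Multipliers] -/
theorem relCost_shift (c : ι → κ → ℝ) (u : ι → ℝ) (v : κ → ℝ) (t : ℝ) (i : ι) (j : κ) :
    relCost c (fun i => u i + t) (fun j => v j - t) i j = relCost c u v i j := by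
  simp only [relCost]; ring

end Literature.Analysis.Convex.TransportationProblem
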